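import Literature.MathematicalPhysics.QuantumLattice.HubbardScaleReportCT
import Literature.MathematicalPhysics.QuantumLattice.TorusCooperSum

/-!
# Crux `AposterioriOrderCriterionR` (item `stmt-HubbardSuperconductivity-13884`): the empty-shell sub-report

Negative-side lemmas of the standing disprover (cdisprove cycle 2; no definition is introduced, every
object is spelled out; companion `HonestCore.lean`).  The crux (`Theses.AposterioriCapRg.AposterioriOrderCriterionR`)
is `∃ kStar etaStar > 0, ∀ U μ h₀ (D : HubbardScaleData), 0 < h₀ → (∀ h ∈ Ioc 0 h₀, ∃ L₀, D.IsCertifiedEnclosure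
(hubbardScaleReportCT U μ D h) L₀) → D.MeetsThresholds kStar etaStar → (D.meanFieldDensity.fst : ℝ)/2 ≤
dWaveOrderParameter U μ`; its hypothesis is typed over the CT report `hubbardScaleReportCT` (union over ADMISSIBLE
counterterm frames `K`, `coeffNorm 2 K ≤ 16`).  These lemmas exhibit the sub-report of frames with EMPTY spatial shell.

* THE EMPTY-SHELL SUB-REPORT.  For a frame `K` whose spatial shell `{|e_K| < Λ₀}` is empty on the torus of
  side `L` (`hshell`): every cutoff weight is `1` (`hubbardCutoffWeightCT_eq_one_of_emptyShell`), the deformed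
  covariance above scale is the whole deformed covariance and nothing is below scale, the scale-`Λ₀` mean-field
  free energy has NO truncated factor (`mfFreeEnergyCT_of_emptyShell`:
  `f^K_MF = -(βL²)⁻¹[log N^K + log|Z^K_full|]`), no Cooper term is kept, the scaled remainder norm is
  `Λ₀³ · ‖constPart 𝒢^K‖ = 0` for EVERY normal form `q` (`scaledRemainderNormCT_eq_zero_of_emptyShell`; the
  effective action never has a constant part, `constPart_effAction_eq_zero`, also in the junk case `Z = 0`);
  hence (`isRealisedAtCT_of_emptyShell`) the CT predicate is NON-VACUOUS AT EVERY COUPLING `U`, unconditionally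
  (the tree had `U = 0` only): the fully integrated responses are realised on no patches with zero remainder and
  arbitrary velocities, and (`mem_reportCTAt_of_emptyShell_limits`) reported modulo convergence in `M`; a non-nodal patch is never certified with a positive gap ratio
  (`mem_nodal_of_realised_emptyShell`); in a CONSTANT frame `K ≡ c` with `μ + c ≤ -4` every reference node
  sits at `Γ` with zero Fermi speed, so `Np = 0` is forced (`numPatches_eq_zero_of_realised_constFrame`).
* `exists_admissible_emptyShell_frame` — such frames exist inside the admissible ball for every
  `μ ∈ [-20 - Λ₀, 12 - Λ₀]`: the constant frame `K ≡ -(μ + 4 + Λ₀)` (`coeffNorm r = |μ + 4 + Λ₀| ≤ 16`) has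
  `e_K = ε_L + 4 + Λ₀ ≥ Λ₀` on EVERY torus and `μ + c = -4 - Λ₀ ≤ -4`.
* `exists_admissible_flat_frame` — the admissibility bound is ATTAINED by the bare band: `K = ε = -4h_{1,0}` has
  `coeffNorm 2 = 16`, and at `μ = 0` its renormalised band, band gradient and Fermi speed vanish identically on
  every torus (every momentum in the shell, nodal pins report `v_F = 0`).

On paper (workfile `Cruxes/AposterioriOrderCriterionR/Disproof.lean` §6, §8): in an empty-shell frame
`f^K_MF` is the Matsubara-truncated grand potential of the deformed seeded torus (Gaussian change of measure),
so the reported `m₀` converges to the TRUE sourced anomalous density `dWaveSourceDensity L U μ h` — the CT report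
is honest with `c = 1` on this sub-report, the remainder threshold never binds there, and a refutation of the
crux must come from a NON-EMPTY shell at `U ≠ 0`.
-/

noncomputable section

namespace Summit.HubbardSuperconductivity.HubbardSuperconductivity.Theorems.AposterioriOrderCriterionR.Negative

open Literature.MathematicalPhysics.QuantumLattice Literature.Probability.LatticeModels
open Filter Set GrassmannAlgebra

/-! ### The empty-shell sub-report: everything above scale, nothing truncated -/

section EmptyShell

variable {L M : ℕ} {μ Λ₀ : ℝ} {K : TrigPolyC4v}

/-- **Every CT cutoff weight is `1` when the spatial shell is empty** (`χ₂ = 1` on `[1, ∞)`; `Λ₀ > 0`). [folklore] -/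
theorem hubbardCutoffWeightCT_eq_one_of_emptyShell (hΛ : 0 < Λ₀) (hshell : ∀ k : TorusSite 2 L, Λ₀ ≤ |nambuXiCT L μ K k|)
    (β : ℝ) (k : FreqMomentum L M) : hubbardCutoffWeightCT L M β μ K Λ₀ k = 1 := by
  rw [hubbardCutoffWeightCT]
  apply salmhoferCutoff_of_ge
  rw [le_div_iff₀ (by positivity), one_mul]
  have h1 := hshell k.2
  have h2 : Λ₀ ^ 2 ≤ nambuXiCT L μ K k.2 ^ 2 := by
    rw [← sq_abs (nambuXiCT L μ K k.2)]; exact pow_le_pow_left₀ hΛ.le h1 2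
  nlinarith [sq_nonneg (matsubaraFreq β M k.1)]

/-- No frequency–momentum label is below scale when the spatial shell is empty. [folklore] -/
theorem not_inFreqShellCT_of_emptyShell [NeZero L] (hΛ : 0 < Λ₀) (hshell : ∀ k : TorusSite 2 L, Λ₀ ≤ |nambuXiCT L μ K k|)
    (β : ℝ) (k : FreqMomentum L M) : ¬ InFreqShellCT L M β μ K Λ₀ k := by
  rw [InFreqShellCT, not_lt]
  have h2 : Λ₀ ^ 2 ≤ nambuXiCT L μ K k.2 ^ 2 := by
    rw [← sq_abs (nambuXiCT L μ K k.2)]; exact pow_le_pow_left₀ hΛ.le (hshell k.2) 2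
  nlinarith [sq_nonneg (matsubaraFreq β M k.1)]

/-- Every CT patch-shell is empty when the spatial shell is. [folklore] -/
theorem patchShellCT_eq_empty_of_emptyShell [NeZero L] (hshell : ∀ k : TorusSite 2 L, Λ₀ ≤ |nambuXiCT L μ K k|)
    (Np : ℕ) (i : Fin Np) : patchShellCT L μ K Λ₀ Np i = ∅ := by
  ext k
  simp only [Finset.notMem_empty, iff_false]
  rw [mem_patchShellCT_iff, not_and, not_lt]
  exact fun _ => hshell k

/-- **Everything is above scale**: the deformed covariance above scale IS the deformed covariance, for every
deformation `(μ', h', a)`. [folklore] -/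
theorem deformedCovAboveCT_of_emptyShell (hΛ : 0 < Λ₀) (hshell : ∀ k : TorusSite 2 L, Λ₀ ≤ |nambuXiCT L μ K k|)
    (β μ' h' a : ℝ) : deformedCovAboveCT L M β μ K Λ₀ μ' h' a = deformedCovarianceCT L M β μ' h' K a := by
  ext X Y
  simp only [deformedCovAboveCT, Matrix.of_apply, hubbardCutoffWeightCT_eq_one_of_emptyShell hΛ hshell]
  norm_num

/-- … and nothing is below scale. [folklore] -/
theorem deformedCovBelowCT_of_emptyShell (hΛ : 0 < Λ₀) (hshell : ∀ k : TorusSite 2 L, Λ₀ ≤ |nambuXiCT L μ K k|)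
    (β μ' h' a : ℝ) : deformedCovBelowCT L M β μ K Λ₀ μ' h' a = 0 := by
  rw [deformedCovBelowCT, deformedCovAboveCT_of_emptyShell hΛ hshell, sub_self]

/-- Undeformed version: `C^{K,>}_{Λ₀} = C^K`. [folklore] -/
theorem hubbardCovAboveCT_of_emptyShell (hΛ : 0 < Λ₀) (hshell : ∀ k : TorusSite 2 L, Λ₀ ≤ |nambuXiCT L μ K k|)
    (β h : ℝ) : hubbardCovAboveCT L M β μ h K Λ₀ = hubbardCovarianceCT L M β μ h K := by
  ext X Y
  simp only [hubbardCovAboveCT, Matrix.of_apply, hubbardCutoffWeightCT_eq_one_of_emptyShell hΛ hshell]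
  norm_num

variable [NeZero L]

/-- **The CT effective action of an empty-shell frame is the FULLY INTEGRATED functional**
`effAction C^K (V + 𝒩_K)`. [folklore] -/
theorem hubbardEffectiveActionCT_of_emptyShell (hΛ : 0 < Λ₀) (hshell : ∀ k : TorusSite 2 L, Λ₀ ≤ |nambuXiCT L μ K k|)
    (β U h : ℝ) :
    hubbardEffectiveActionCT L M β U μ h K Λ₀ =
      effAction ℂ (hubbardCovarianceCT L M β μ h K) (hubbardInteractionCT L M β U K) := by
  rw [hubbardEffectiveActionCT, hubbardCovAboveCT_of_emptyShell hΛ hshell]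

omit [NeZero L] in
/-- The quadratic part of a Grassmann polynomial has no constant part. [folklore] -/
theorem constPart_quadraticPart {Γ : Type*} [Fintype Γ] [DecidableEq Γ] (F : GrassmannAlgebra ℂ Γ) :
    constPart ℂ (quadraticPart F) = 0 := by
  simp [quadraticPart, map_sum]

omit [NeZero L] in
/-- `∫ dμ_0 e^{-F₂} = 1`: with zero covariance the Gaussian expectation is the constant part, and the
exponential of a quadratic form has constant part `1`. [folklore] -/
theorem gaussExpect_zero_grassmannExp_neg_quadraticPart {Γ : Type*} [Fintype Γ] [DecidableEq Γ]
    (F : GrassmannAlgebra ℂ Γ) : gaussExpect ℂ (0 : Matrix Γ Γ ℂ) (grassmannExp (-quadraticPart F)) = 1 := by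
  have h0 : constPart ℂ (-quadraticPart F) = 0 := by rw [map_neg, constPart_quadraticPart, neg_zero]
  have hn : IsNilpotent (-quadraticPart F) := isNilpotent_of_constPart_eq_zero ℂ h0
  rw [gaussExpect_apply, gaussConv_zero, Module.End.one_apply, grassmannExp, IsNilpotent.map_exp hn, h0,
    IsNilpotent.exp_zero]

/-- **No truncated factor in an empty-shell frame**: `f^K_MF(a, μ', h') = -(βL²)⁻¹[log N^K + log |Z^K_full|]` with
`Z^K_full = ∫ dμ_{C^K_{a,μ',h'}} e^{-V-𝒩_K}` — the Matsubara-truncated grand potential of the deformed seeded torus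
itself, re-bracketed (the below-scale integral is over the ZERO covariance and equals `1`). [folklore] -/
theorem mfFreeEnergyCT_of_emptyShell (hΛ : 0 < Λ₀) (hshell : ∀ k : TorusSite 2 L, Λ₀ ≤ |nambuXiCT L μ K k|)
    (β U μ' h' a : ℝ) :
    mfFreeEnergyCT L M β U μ K Λ₀ μ' h' a =
      -(1 / (β * (L : ℝ) ^ 2)) *
        (freeLogDetCT L M β μ' h' K a +
          Real.log ‖effPartitionFn ℂ (deformedCovarianceCT L M β μ' h' K a) (hubbardInteractionCT L M β U K)‖) := by
  rw [mfFreeEnergyCT, deformedCovBelowCT_of_emptyShell hΛ hshell, gaussExpect_zero_grassmannExp_neg_quadraticPart,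
    norm_one, Real.log_one, add_zero, deformedEffPartitionFnCT, deformedCovAboveCT_of_emptyShell hΛ hshell]

/-- **No Cooper term is kept in an empty-shell frame** (no leg is below scale). [folklore] -/
theorem cooperKeptCT_of_emptyShell (hΛ : 0 < Λ₀) (hshell : ∀ k : TorusSite 2 L, Λ₀ ≤ |nambuXiCT L μ K k|)
    (β : ℝ) (F : HubbardGrassmann L M) : cooperKeptCT L M β μ K Λ₀ F = 0 := by
  classical
  simp [cooperKeptCT, not_inFreqShellCT_of_emptyShell hΛ hshell]

omit [NeZero L] in
/-- A leg-weighted norm with the ZERO weight vanishes in every positive degree. [folklore] -/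
theorem legKernelNorm_zero_weight {𝕜 : Type*} [RCLike 𝕜] {Γ : Type*} [Fintype Γ] [DecidableEq Γ]
    (ε : ℝ) (m : ℕ) (F : (Fin (m + 1) → Γ) → 𝕜) : legKernelNorm (fun _ : Γ => (0 : ℝ)) ε (m + 1) F = 0 := by
  rw [legKernelNorm_succ]
  simp

/-- The quadratic quasiparticle form has no constant part. [folklore] -/
theorem constPart_normalFormQuadratic (β : ℝ) {Np : ℕ} (q : HubbardNormalForm L Np) :
    constPart ℂ (normalFormQuadratic L M β q) = 0 := by
  simp [normalFormQuadratic, map_sum, psiPlus, psiMinus, -Complex.coe_smul]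

/-- **The CT scaled remainder norm of an empty-shell frame is `Λ₀³ · ‖const part of 𝒢^K‖`, for EVERY
normal-form datum `q`** (all leg weights `√(1 - w) = 0`; only the degree-`0` kernel survives). [folklore] -/
theorem scaledRemainderNormCT_of_emptyShell (hΛ : 0 < Λ₀) (hshell : ∀ k : TorusSite 2 L, Λ₀ ≤ |nambuXiCT L μ K k|)
    (β U h : ℝ) {Np : ℕ} (q : HubbardNormalForm L Np) :
    scaledRemainderNormCT L M β U μ h K Λ₀ q = Λ₀ ^ (3 : ℤ) * ‖constPart ℂ (hubbardEffectiveActionCT L M β U μ h K Λ₀)‖ := by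
  have hw1 : shellLegWeightCT L M β μ K Λ₀ = fun _ => 0 := by
    funext X
    rw [shellLegWeightCT, hubbardCutoffWeightCT_eq_one_of_emptyShell hΛ hshell, sub_self, Real.sqrt_zero]
  have hw2 : energyLegWeightCT L M β μ h K Λ₀ q = fun _ => 0 := by
    funext X
    rw [energyLegWeightCT, hubbardCutoffWeightCT_eq_one_of_emptyShell hΛ hshell, sub_self, zero_mul, Real.sqrt_zero]
  rw [scaledRemainderNormCT, Finset.sum_eq_single_of_mem 0 (by simp)]
  · simp only [CharP.cast_eq_zero, mul_zero, zero_sub, neg_neg, if_neg (show (0:ℕ) ≠ 2 by decide),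
      legKernelNorm_zero_left, weightedKernel_def, pow_zero, kernel_zero, remainderOfCT,
      cooperKeptCT_of_emptyShell hΛ hshell, sub_zero, map_sub, constPart_normalFormQuadratic]
    simp
  · intro m _ hm
    obtain ⟨m, rfl⟩ := Nat.exists_eq_succ_of_ne_zero hm
    have hw : (if m + 1 = 2 then shellLegWeightCT L M β μ K Λ₀ else energyLegWeightCT L M β μ h K Λ₀ q) = fun _ => 0 := by
      split_ifs
      · exact hw1
      · exact hw2
    rw [hw, legKernelNorm_zero_weight, mul_zero]

omit [NeZero L] in
/-- **The Wilsonian effective action never has a constant part** — also in the junk case `Z` not a unit,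
where `effAction = -log1p(0 • B - 1) = -log1p(-1) = 0` (the truncated logarithm of a non-nilpotent element is
the empty sum): `constPart` of the (always nilpotent) `grassmannLog1p` is a nilpotent complex number. [folklore] -/
theorem constPart_effAction_eq_zero {Γ : Type*} [Fintype Γ] (C : Matrix Γ Γ ℂ) (V : GrassmannAlgebra ℂ Γ) :
    constPart ℂ (effAction ℂ C V) = 0 := by
  rw [effAction_def, map_neg, neg_eq_zero]
  exact ((isNilpotent_grassmannLog1p ℂ _).map (constPart ℂ)).eq_zero

/-- … hence **the CT scaled remainder norm of an empty-shell frame VANISHES, for every normal form `q` and all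
parameters** (no hypothesis on `Z`). [folklore] -/
theorem scaledRemainderNormCT_eq_zero_of_emptyShell (hΛ : 0 < Λ₀) (hshell : ∀ k : TorusSite 2 L, Λ₀ ≤ |nambuXiCT L μ K k|)
    (β U h : ℝ) {Np : ℕ} (q : HubbardNormalForm L Np) :
    scaledRemainderNormCT L M β U μ h K Λ₀ q = 0 := by
  rw [scaledRemainderNormCT_of_emptyShell hΛ hshell, hubbardEffectiveActionCT, constPart_effAction_eq_zero,
    norm_zero, mul_zero]

/-- **Non-vacuity of the CT predicate AT EVERY COUPLING, unconditionally.**  In an empty-shell frame the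
responses of the fully integrated functional are realised ON NO PATCHES with ZERO remainder and ARBITRARY
velocities `vF, vΔ`, for every `L ≥ 1`, `M`, `β > 0`, `U`, `h` (the tree's `isRealisedAtCT_free_noPatch` is
the case `U = 0`, `K = 0`). [folklore] -/
theorem isRealisedAtCT_of_emptyShell (hΛ : 0 < Λ₀) (hshell : ∀ k : TorusSite 2 L, Λ₀ ≤ |nambuXiCT L μ K k|)
    {β : ℝ} (hβ : 0 < β) (U h vF vΔ : ℝ) :
    IsRealisedAtCT L M β U μ h K Λ₀ 0 ∅
      ⟨Fin.elim0, scaleStiffnessCT L M β U μ h K Λ₀, scaleCompressibilityCT L M β U μ h K Λ₀, vF, vΔ, 0,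
        scaleMeanFieldDensityCT L M β U μ h K Λ₀⟩ :=
  ⟨hβ, HubbardNormalForm.trivial L 0, HubbardNormalForm.trivial_isEven L, fun i => i.elim0, fun i _ => i.elim0,
    fun i _ => i.elim0, rfl, rfl, rfl, (scaledRemainderNormCT_eq_zero_of_emptyShell hΛ hshell β U h _).le⟩

/-- **The CT report is inhabited at every coupling, modulo convergence in `M`**: if the shell of an admissible
frame `K` is empty on the torus of side `L ≥ 1` and the three Matsubara-truncated responses converge as `M → ∞`,
the limit tuple — ANY velocities, ZERO remainder — is reported on no patches at `(L, β)`, `β > 0`. [folklore] -/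
theorem mem_reportCTAt_of_emptyShell_limits (hK : IsAdmissibleFrame K) (hΛ : 0 < Λ₀)
    (hshell : ∀ k : TorusSite 2 L, Λ₀ ≤ |nambuXiCT L μ K k|) {β : ℝ} (hβ : 0 < β) (U h vF vΔ ρ κ m : ℝ)
    (hρ : Tendsto (fun M => scaleStiffnessCT L M β U μ h K Λ₀) atTop (nhds ρ))
    (hκ : Tendsto (fun M => scaleCompressibilityCT L M β U μ h K Λ₀) atTop (nhds κ))
    (hm : Tendsto (fun M => scaleMeanFieldDensityCT L M β U μ h K Λ₀) atTop (nhds m)) :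
    (⟨Fin.elim0, ρ, κ, vF, vΔ, 0, m⟩ : HubbardScaleData.Parameters 0) ∈ hubbardScaleReportCTAt U μ h Λ₀ 0 ∅ L β := by
  rw [mem_hubbardScaleReportCTAt_iff]
  intro δ hδ
  have hρ' := (Metric.tendsto_nhds.1 hρ) δ hδ
  have hκ' := (Metric.tendsto_nhds.1 hκ) δ hδ
  have hm' := (Metric.tendsto_nhds.1 hm) δ hδ
  refine ((hρ'.and (hκ'.and hm')).mono fun M ⟨hρM, hκM, hmM⟩ => ?_).frequently
  refine ⟨K, hK, _, isRealisedAtCT_of_emptyShell hΛ hshell hβ U h vF vΔ, fun i => i.elim0, ?_, ?_, by simp [hδ],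
    by simp [hδ], by simp [hδ], ?_⟩
  · simpa [Real.dist_eq, abs_sub_comm] using hρM
  · simpa [Real.dist_eq, abs_sub_comm] using hκM
  · simpa [Real.dist_eq, abs_sub_comm] using hmM

/-- **A non-nodal patch is never certified through an empty-shell frame**: a tuple realised in a frame whose
shell is empty at the datum's own scale reports the gap `0` on every patch, so if it is enclosed by a datum
meeting the thresholds with a positive gap ratio `c` then every patch is declared nodal. [folklore] -/
theorem mem_nodal_of_realised_emptyShell (D : HubbardScaleData) {K : TrigPolyC4v}
    (hshell : ∀ k : TorusSite 2 L, (D.scale : ℝ) ≤ |nambuXiCT L μ K k|) {β U h : ℝ}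
    {p : HubbardScaleData.Parameters D.numPatches} (hp : IsRealisedAtCT L M β U μ h K (D.scale : ℝ) D.numPatches D.nodal p)
    (henc : D.Encloses p) {c kStar etaStar : ℚ} (hc : 0 < c) (hthr : D.MeetsThresholdsWith c kStar etaStar)
    (i : Fin D.numPatches) : i ∈ D.nodal := by
  by_contra hi
  obtain ⟨-, q, -, hgap, -⟩ := hp
  obtain ⟨-, -, -, -, -, -, hg, -⟩ := hthr
  obtain ⟨hgenc, -⟩ := henc
  have h0 : p.gap i = 0 := (hgap i).eq_zero (patchShellCT_eq_empty_of_emptyShell hshell D.numPatches i)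
  have hgi := hgenc i
  rw [h0, NonemptyInterval.mem_ratCast_iff] at hgi
  have hcΛ : (0 : ℝ) < c * D.scale := by
    have : (0 : ℚ) < c * D.scale := mul_pos hc D.scale_pos
    exact_mod_cast this
  rcases hg i hi with h | h
  · have h' : ((c * D.scale : ℚ) : ℝ) ≤ (D.gap i).fst := Rat.cast_le.2 h
    push_cast at h'
    linarith [hgi.1]
  · have h' : ((D.gap i).snd : ℝ) ≤ ((-(c * D.scale) : ℚ) : ℝ) := Rat.cast_le.2 h
    push_cast at h'
    linarith [hgi.2]

omit [NeZero L] in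
/-- A degree-`0` (constant) frame evaluates to its coefficient `κ_{0,0}`. [folklore] -/
theorem eval_of_degree_zero (hK : K.degree = 0) (p : Fin 2 → ℝ) : K.eval p = K.coeff 0 0 := by
  simp [TrigPolyC4v.eval, hK, TrigPolyC4v.harmonic]

omit [NeZero L] in
/-- A degree-`0` frame has zero gradient. [folklore] -/
theorem evalGrad_of_degree_zero (hK : K.degree = 0) (p : Fin 2 → ℝ) : K.evalGrad p = 0 := by
  funext i
  fin_cases i <;> simp [TrigPolyC4v.evalGrad, hK, TrigPolyC4v.harmonicGrad]

omit [NeZero L] in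
/-- In a constant frame `K ≡ c` with `μ + c ≤ -4` the "renormalised Fermi radius" is the junk value `0` in every
direction (the defining set is `[0, ∞)`), so every reference node sits at `Γ = 0`. [folklore] -/
theorem nodePointCT_of_degree_zero (hK : K.degree = 0) (hc : μ + K.coeff 0 0 ≤ -4) (Np : ℕ) (i : Fin Np) :
    nodePointCT μ K Np i = 0 := by
  have hray : ∀ θ, fermiRayCT μ K θ = 0 := fun θ => by
    rw [fermiRayCT]
    have hset : {t : ℝ | 0 ≤ t ∧ μ + K.eval (t • dir θ) ≤ sqDispersion (t • dir θ)} = Set.Ici 0 := by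
      ext t
      simp only [Set.mem_setOf_eq, Set.mem_Ici, eval_of_degree_zero hK, and_iff_left_iff_imp]
      exact fun _ => hc.trans (neg_four_le_sqDispersion _)
    rw [hset, csInf_Ici]
  rw [nodePointCT, hray, zero_smul]

omit [NeZero L] in
/-- … where the renormalised Fermi speed vanishes (`∇ε(0) = 0`, `∇K = 0`). [folklore] -/
theorem fermiSpeedCT_node_of_degree_zero (hK : K.degree = 0) (hc : μ + K.coeff 0 0 ≤ -4) (Np : ℕ) (i : Fin Np) :
    fermiSpeedCT K (nodePointCT μ K Np i) = 0 := by
  rw [nodePointCT_of_degree_zero hK hc, fermiSpeedCT, bandGradientCT, evalGrad_of_degree_zero hK, sub_zero]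
  have : bandGradient 0 = 0 := by funext j; fin_cases j <;> simp [bandGradient]
  simp [this]

/-- **`Np = 0` is forced in the constant empty-shell frames.**  If a tuple realised in a CONSTANT frame `K ≡ c`
with `μ + c ≤ -4` whose shell is empty at the datum's scale is enclosed by a datum meeting the thresholds
(positive gap ratio), the datum has NO patches: non-nodal patches report the gap `0`, nodal ones `v_F = 0`.
[folklore] -/
theorem numPatches_eq_zero_of_realised_constFrame (D : HubbardScaleData) {K : TrigPolyC4v} (hK : K.degree = 0)
    (hc : μ + K.coeff 0 0 ≤ -4) (hshell : ∀ k : TorusSite 2 L, (D.scale : ℝ) ≤ |nambuXiCT L μ K k|) {β U h : ℝ}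
    {p : HubbardScaleData.Parameters D.numPatches} (hp : IsRealisedAtCT L M β U μ h K (D.scale : ℝ) D.numPatches D.nodal p)
    (henc : D.Encloses p) {c kStar etaStar : ℚ} (hc' : 0 < c) (hthr : D.MeetsThresholdsWith c kStar etaStar) :
    D.numPatches = 0 := by
  by_contra hN
  set i : Fin D.numPatches := ⟨0, Nat.pos_of_ne_zero hN⟩
  have hi : i ∈ D.nodal := mem_nodal_of_realised_emptyShell D hshell hp henc hc' hthr i
  obtain ⟨-, q, -, -, -, hnod, -⟩ := hp
  obtain ⟨-, hvF, -⟩ := hthr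
  obtain ⟨-, -, -, hvFenc, -⟩ := henc
  obtain ⟨-, -, -, hv, -⟩ := hnod i hi
  rw [fermiSpeedCT_node_of_degree_zero hK hc, mul_zero, zero_div] at hv
  rw [hv, NonemptyInterval.mem_ratCast_iff] at hvFenc
  have : (0 : ℝ) < D.fermiVelocity.fst := by exact_mod_cast hvF
  linarith [hvFenc.1]

omit [NeZero L] in
/-- **Admissible empty-shell frames exist for every `μ` with `|μ + 4 + Λ₀| ≤ 16`** (`Λ₀ ≥ 0`): the constant
frame `K ≡ -(μ + 4 + Λ₀)` has `coeffNorm 2 = |μ + 4 + Λ₀|`, `e_K = ε_L + 4 + Λ₀ ≥ Λ₀` on EVERY torus and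
`μ + c = -4 - Λ₀ ≤ -4`. [folklore] -/
theorem exists_admissible_emptyShell_frame (μ : ℝ) {Λ₀ : ℝ} (hΛ : 0 ≤ Λ₀) (hadm : |μ + 4 + Λ₀| ≤ 16) :
    ∃ K : TrigPolyC4v, IsAdmissibleFrame K ∧ K.degree = 0 ∧ μ + K.coeff 0 0 ≤ -4 ∧
      ∀ (L : ℕ) (k : TorusSite 2 L), Λ₀ ≤ nambuXiCT L μ K k := by
  refine ⟨⟨0, fun m n => if m = 0 ∧ n = 0 then -(μ + 4 + Λ₀) else 0⟩, ?_, rfl, ?_, fun L k => ?_⟩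
  · rw [isAdmissibleFrame_iff]
    simp only [TrigPolyC4v.coeffNorm, zero_add, Finset.sum_range_one, Nat.cast_zero, add_zero, one_pow, one_mul,
      and_self, ite_true, abs_neg]
    exact hadm
  · simp; linarith
  · rw [nambuXiCT, eval_of_degree_zero rfl]
    simp only [and_self, if_true]
    linarith [neg_four_le_torusBand L k]


/-- **Headline: the CT predicate is inhabited with ZERO remainder at every coupling.**  For every `μ`, `Λ₀ > 0` with
`|μ + 4 + Λ₀| ≤ 16`, every `L ≥ 1`, `M`, `β > 0`, `U`, `h` and any velocities there is an ADMISSIBLE frame realising a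
0-patch tuple with remainder norm `0` — so the remainder threshold `η ≤ etaStar` of the crux excludes nothing on this
sub-report, whatever `etaStar ≥ 0`. [folklore] -/
theorem exists_admissible_realised_zero_remainder (μ : ℝ) {Λ₀ : ℝ} (hΛ : 0 < Λ₀) (hadm : |μ + 4 + Λ₀| ≤ 16)
    {β : ℝ} (hβ : 0 < β) (U h vF vΔ : ℝ) :
    ∃ K : TrigPolyC4v, IsAdmissibleFrame K ∧ ∃ p : HubbardScaleData.Parameters 0,
      p.remainderNorm = 0 ∧ p.fermiVelocity = vF ∧ p.gapVelocity = vΔ ∧ IsRealisedAtCT L M β U μ h K Λ₀ 0 ∅ p := by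
  obtain ⟨K, hK, -, -, hshell⟩ := exists_admissible_emptyShell_frame μ hΛ.le hadm
  exact ⟨K, hK, _, rfl, rfl, rfl,
    isRealisedAtCT_of_emptyShell hΛ (fun k => (hshell L k).trans (le_abs_self _)) hβ U h vF vΔ⟩

end EmptyShell

/-! ### The admissibility bound is attained by the bare band -/

/-- **The flat-band frame is admissible.**  `K = ε = -4 h_{1,0}` has `coeffNorm 2 = 16` EXACTLY (the designer's
bound `reportFrameBound`), and at `μ = 0` its renormalised band `e_K = ε_L - 0 - ε(p_k)`, its band gradient
`∇ε - ∇K` and its Fermi speed vanish IDENTICALLY: every momentum of every torus is in the spatial shell and every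
nodal pin reports `v_F = 0`.  (Planner note: `< 16`, or a floor on `|∇e_K|` along `{e_K = 0}`, would exclude it.)
[folklore] -/
theorem exists_admissible_flat_frame :
    ∃ K : TrigPolyC4v, IsAdmissibleFrame K ∧ K.coeffNorm 2 = 16 ∧
      (∀ (L : ℕ) (k : TorusSite 2 L), nambuXiCT L 0 K k = 0) ∧
      (∀ p, bandGradientCT K p = 0) ∧ (∀ p, fermiSpeedCT K p = 0) := by
  set K : TrigPolyC4v := ⟨1, fun m n => if m = 1 ∧ n = 0 then -4 else 0⟩ with hKdef
  have heval : ∀ p, K.eval p = sqDispersion p := fun p => by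
    simp [hKdef, TrigPolyC4v.eval, Finset.sum_range_succ, TrigPolyC4v.harmonic, sqDispersion]; ring
  have hnorm : K.coeffNorm 2 = 16 := by
    simp [hKdef, TrigPolyC4v.coeffNorm, Finset.sum_range_succ]; norm_num
  have hgrad : ∀ p, bandGradientCT K p = 0 := fun p => by
    rw [bandGradientCT, sub_eq_zero]
    funext i
    fin_cases i <;>
      simp [hKdef, TrigPolyC4v.evalGrad, Finset.sum_range_succ, TrigPolyC4v.harmonicGrad, bandGradient] <;> ring
  refine ⟨K, by rw [isAdmissibleFrame_iff, hnorm], hnorm, fun L k => ?_, hgrad, fun p => by simp [fermiSpeedCT, hgrad]⟩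
  rw [nambuXiCT, heval, torusBand, sqDispersion, Fin.sum_univ_two]
  ring

end Summit.HubbardSuperconductivity.HubbardSuperconductivity.Theorems.AposterioriOrderCriterionR.Negative
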